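import Summits.CriticalPhenomena.PercolationContinuityZ3.Theorems.PercNearOneGluingNoHeavyLowerTailSunflowerRainbowIntersecting
import HarnessLib
import HarnessLib.Audit

/-!
# `NoHeavyLowerTail` (crux stmt-CriticalPhenomena-4575), abstract sunflower cubic: the cube-by-cube form of ★ and the typed conjecture
# `BottomSlackPaysRainbows` (★_B) — the Gladkov slack of the BOTTOM-spectator cubes alone pays for the rainbows

Support file (seat `prim-l12-p2` gen 20; `--supports stmt-CriticalPhenomena-4575`).  No `sorry`.  Definitions: `Sunflower.abCard`,
`Sunflower.crCard`, `Sunflower.cubeSlack`, `Sunflower.rainbowCard` and the `@[conjecture]` `BottomSlackPaysRainbows` (an obligation of this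
programme — census-true, unproved —, never a fact).  Memo: run/shared/lean/prim/prim-l12/prim-l12-p2/FINDING-g20-COMPLEMENT-READING.md §4.

For a cube `W` let `AB(W) = {O ⊆ W : lab O = 0, lab (W∖O) = 4}` (kernel–bottom antipodal pairs) and `CR(W)` = the cross antipodal pairs listed by
their larger-label side (`mk_mem_dem`'s normal form).  The GLADKOV SLACK of the cube is `cubeSlack W = #AB(W) − #CR(W) ≥ 0` (cube theorem,
`card_cross_filter_le`).  Grouping supplies and spectator demands by their spectator block:

* `Sunflower.card_sup_eq` : `#sup = Σ_{lab S ∈ {0,4}} #AB(Sᶜ)`;  `Sunflower.card_dem_eq` : `#dem = #rainbows + Σ_{lab S ∈ {0,4}} #CR(Sᶜ)`;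
* `Sunflower.ZH_eq_six_slack` : **`ZH = 6·( Σ_{lab S = 0} cubeSlack Sᶜ + Σ_{lab S = 4} cubeSlack Sᶜ − #rainbows )`** — so ★ (`0 ≤ ZH`) says
  exactly that the total Gladkov slack of the cubes pays for the rainbows.
* `BottomSlackPaysRainbows` (★_B, typed conjecture, NEW): `#rainbows ≤ Σ_{lab S = 0} cubeSlack Sᶜ` — the BOTTOM-spectator cubes alone pay.
  CENSUS (gen 20): n = 3, 4, 5 EXHAUSTIVE (all 275 665 902 monotone maps `2^5 → M₃`, 2 890 800 with rainbows; 0 failures, 1 320 tight), n = 6, 7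
  sampled (10 000 instances, four generators incl. all-petals-non-intersecting; 0 failures); TIGHT on the whole pool-structured hard family.
  In the GF(2) programme it says: `#rainbows` independent vectors should be found in `⊕_{lab S = 0} ker M_{Sᶜ}` alone (the strong, `ν`-type side).
* `partitionLemmaH_of_bottomSlackPaysRainbows : BottomSlackPaysRainbows → PartitionLemmaH` (the kernel-spectator slack is nonnegative).
-/

namespace Summit.CriticalPhenomena.PercolationContinuityZ3.Theorems.SunflowerPartition

open Finset

namespace Sunflower

variable {α : Type*} [Fintype α] [DecidableEq α] (F : Sunflower α)

/-! ## Cube counts -/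

/-- `#AB(W)`: the kernel–bottom antipodal pairs of the cube `W`, listed by the bottom side `O` (`lab O = 0`, `lab (W∖O) = 4`). [this work] -/
def abCard (W : Finset α) : ℕ := (W.powerset.filter (fun O => F.lab O = 0 ∧ F.lab (W \ O) = 4)).card

/-- `#CR(W)`: the cross antipodal pairs of the cube `W`, listed by the larger-label side `Y`. [this work] -/
def crCard (W : Finset α) : ℕ :=
  (W.powerset.filter (fun Y => F.lab Y ≠ 0 ∧ F.lab Y ≠ 4 ∧ F.lab (W \ Y) ≠ 0 ∧ F.lab (W \ Y) ≠ 4 ∧ F.lab (W \ Y) < F.lab Y)).card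

/-- The GLADKOV SLACK `#AB(W) − #CR(W)` of the cube `W`. [this work] -/
def cubeSlack (W : Finset α) : ℤ := (F.abCard W : ℤ) - (F.crCard W : ℤ)

/-- The number of rainbows `(Q1,Q2,Q3)` (word `(1,2,3)`). [this work] -/
def rainbowCard : ℕ := (F.dem.filter (fun d => F.IsRainbow d)).card

/-- The Gladkov slack of every cube is nonnegative (cube theorem, `card_cross_filter_le` with `D` = everything). [this work] -/
theorem cubeSlack_nonneg (W : Finset α) : 0 ≤ F.cubeSlack W := by
  classical
  have h := F.card_cross_filter_le W (Finset.univ : Finset (Finset α)) (by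
    intro a b _ _; exact mem_coe.2 (mem_univ _))
  rw [Finset.filter_true_of_mem (fun _ _ => mem_univ _), Finset.filter_true_of_mem (fun _ _ => mem_univ _)] at h
  unfold cubeSlack abCard crCard
  omega

/-! ## Grouping supplies and demands by the spectator block -/

/-- The supplies with spectator block `S` are in bijection with `AB(Sᶜ)` (bottom block `O = (X' ∪ S)ᶜ`). [this work] -/
theorem card_sup_fiber (S : Finset α) :
    (F.sup.filter (fun σ => σ.2 = S)).card = if F.lab S = 4 ∨ F.lab S = 0 then F.abCard Sᶜ else 0 := by
  by_cases hS : F.lab S = 4 ∨ F.lab S = 0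
  · rw [if_pos hS]
    unfold abCard
    refine Finset.card_bij' (fun σ _ => (σ.1 ∪ σ.2)ᶜ) (fun O _ => (Sᶜ \ O, S)) ?_ ?_ ?_ ?_
    · intro σ hσ
      obtain ⟨hσs, hσS⟩ := mem_filter.1 hσ
      obtain ⟨hdisj, h4, -, h0⟩ := F.sup_facts hσs
      have e : Sᶜ \ (σ.1 ∪ σ.2)ᶜ = σ.1 := by rw [← hσS, union_comm]; exact compl_sdiff_third hdisj.symm
      refine mem_filter.2 ⟨mem_powerset.2 ?_, h0, by rw [e]; exact h4⟩
      rw [← hσS, union_comm]; exact third_subset_compl σ.2 σ.1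
    · intro O hO
      obtain ⟨hOW, hO0, hO4⟩ := mem_filter.1 hO
      exact mem_filter.2 ⟨F.mk_mem_sup (mem_powerset.1 hOW) hS hO0 hO4, rfl⟩
    · intro σ hσ
      obtain ⟨hσs, hσS⟩ := mem_filter.1 hσ
      obtain ⟨hdisj, -⟩ := F.sup_facts hσs
      have e : Sᶜ \ (σ.1 ∪ σ.2)ᶜ = σ.1 := by rw [← hσS, union_comm]; exact compl_sdiff_third hdisj.symm
      rw [e]; rcases σ with ⟨a, b⟩; simp only at hσS ⊢; rw [hσS]
    · intro O hO
      exact third_of_mk (mem_powerset.1 (mem_filter.1 hO).1)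
  · rw [if_neg hS, Finset.card_eq_zero, Finset.filter_eq_empty_iff]
    intro σ hσ hσS
    obtain ⟨-, -, h2, -⟩ := F.sup_facts hσ
    rw [hσS] at h2
    exact hS h2

/-- The non-rainbow demands with spectator block `S` are in bijection with `CR(Sᶜ)` (larger side `Y = (S ∪ X)ᶜ`). [this work] -/
theorem card_dem_spec_fiber (S : Finset α) :
    ((F.dem.filter (fun d => ¬ F.IsRainbow d)).filter (fun d => d.1 = S)).card
      = if F.lab S = 4 ∨ F.lab S = 0 then F.crCard Sᶜ else 0 := by
  by_cases hS : F.lab S = 4 ∨ F.lab S = 0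
  · rw [if_pos hS]
    unfold crCard
    refine Finset.card_bij' (fun d _ => (d.1 ∪ d.2)ᶜ) (fun Y _ => (S, Sᶜ \ Y)) ?_ ?_ ?_ ?_
    · intro d hd
      obtain ⟨hdf, hSd⟩ := mem_filter.1 hd
      obtain ⟨hdd, hnr⟩ := mem_filter.1 hdf
      obtain ⟨hdisj, -, hX0, hX4, hY0, hY4, hlt⟩ := F.dem_spec_facts hdd hnr
      have e : Sᶜ \ (d.1 ∪ d.2)ᶜ = d.2 := by rw [← hSd]; exact compl_sdiff_third hdisj
      have hsub : (d.1 ∪ d.2)ᶜ ⊆ Sᶜ := by rw [← hSd]; exact third_subset_compl d.1 d.2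
      refine mem_filter.2 ⟨mem_powerset.2 hsub, hY0, hY4, ?_, ?_, ?_⟩
      · rw [e]; exact hX0
      · rw [e]; exact hX4
      · rw [e]; exact hlt
    · intro Y hY
      obtain ⟨hYW, hY0, hY4, hX0, hX4, hlt⟩ := mem_filter.1 hY
      have hmem := F.mk_mem_dem (mem_powerset.1 hYW) hS hX0 hX4 hY0 hY4 hlt
      exact mem_filter.2 ⟨mem_filter.2 hmem, rfl⟩
    · intro d hd
      obtain ⟨hdf, hSd⟩ := mem_filter.1 hd
      obtain ⟨hdd, hnr⟩ := mem_filter.1 hdf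
      obtain ⟨hdisj, -⟩ := F.dem_spec_facts hdd hnr
      have e : Sᶜ \ (d.1 ∪ d.2)ᶜ = d.2 := by rw [← hSd]; exact compl_sdiff_third hdisj
      rw [e]; rcases d with ⟨a, b⟩; simp only at hSd ⊢; rw [hSd]
    · intro Y hY
      exact third_of_sdiff (mem_powerset.1 (mem_filter.1 hY).1)
  · rw [if_neg hS, Finset.card_eq_zero, Finset.filter_eq_empty_iff]
    intro d hd hdS
    obtain ⟨hdd, hnr⟩ := mem_filter.1 hd
    obtain ⟨-, h2, -⟩ := F.dem_spec_facts hdd hnr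
    rw [hdS] at h2
    exact hS h2.symm

/-- **`#sup = Σ_{lab S ∈ {4,0}} #AB(Sᶜ)`.** [this work] -/
theorem card_sup_eq :
    F.sup.card = ∑ S ∈ (Finset.univ : Finset (Finset α)).filter (fun S => F.lab S = 4 ∨ F.lab S = 0), F.abCard Sᶜ := by
  rw [Finset.card_eq_sum_card_fiberwise (f := fun σ : Finset α × Finset α => σ.2) (t := (Finset.univ : Finset (Finset α)))
    (fun _ _ => mem_coe.2 (mem_univ _))]
  rw [Finset.sum_filter]
  exact sum_congr rfl fun S _ => F.card_sup_fiber S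

/-- **`#dem = #rainbows + Σ_{lab S ∈ {4,0}} #CR(Sᶜ)`.** [this work] -/
theorem card_dem_eq :
    F.dem.card = F.rainbowCard
      + ∑ S ∈ (Finset.univ : Finset (Finset α)).filter (fun S => F.lab S = 4 ∨ F.lab S = 0), F.crCard Sᶜ := by
  unfold rainbowCard
  rw [← Finset.card_filter_add_card_filter_not (s := F.dem) (fun d => F.IsRainbow d)]
  congr 1
  rw [Finset.card_eq_sum_card_fiberwise (f := fun d : Finset α × Finset α => d.1) (t := (Finset.univ : Finset (Finset α)))
    (fun _ _ => mem_coe.2 (mem_univ _))]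
  rw [Finset.sum_filter]
  exact sum_congr rfl fun S _ => F.card_dem_spec_fiber S

/-- **THE CUBE-BY-CUBE FORM OF ★** (this work): `ZH = 6·(Σ_{lab S = 0} cubeSlack Sᶜ + Σ_{lab S = 4} cubeSlack Sᶜ − #rainbows)`. [this work] -/
theorem ZH_eq_six_slack :
    F.ZH = 6 * ((∑ S ∈ (Finset.univ : Finset (Finset α)).filter (fun S => F.lab S = 0), F.cubeSlack Sᶜ)
      + (∑ S ∈ (Finset.univ : Finset (Finset α)).filter (fun S => F.lab S = 4), F.cubeSlack Sᶜ) - (F.rainbowCard : ℤ)) := by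
  rw [F.ZH_eq_six_card_sup_sub_dem, F.card_sup_eq, F.card_dem_eq]
  have hsplit : ∀ g : Finset α → ℤ,
      (∑ S ∈ (Finset.univ : Finset (Finset α)).filter (fun S => F.lab S = 4 ∨ F.lab S = 0), g S)
        = (∑ S ∈ (Finset.univ : Finset (Finset α)).filter (fun S => F.lab S = 0), g S)
          + ∑ S ∈ (Finset.univ : Finset (Finset α)).filter (fun S => F.lab S = 4), g S := by
    intro g
    rw [Finset.filter_or, Finset.sum_union, add_comm]
    exact Finset.disjoint_filter.2 fun S _ h4 h0 => by rw [h4] at h0; exact absurd h0 (by decide)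
  push_cast
  rw [hsplit (fun S => (F.abCard Sᶜ : ℤ)), hsplit (fun S => (F.crCard Sᶜ : ℤ))]
  unfold cubeSlack
  rw [Finset.sum_sub_distrib, Finset.sum_sub_distrib]
  ring

/-! ## The typed conjecture (★_B) and the reduction -/

/-- **(★_B) BOTTOM SLACK PAYS FOR THE RAINBOWS** (this work; OPEN, census-clean — file header): for every sunflower, the number of rainbows is
at most the total Gladkov slack of the BOTTOM-spectator cubes, `#rainbows ≤ Σ_{lab S = 0} (#AB(Sᶜ) − #CR(Sᶜ))`.  An obligation, never a fact:
use as `(h : BottomSlackPaysRainbows)`. [status: open] -/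
@[conjecture] def _root_.Summit.CriticalPhenomena.PercolationContinuityZ3.Theorems.SunflowerPartition.BottomSlackPaysRainbows : Prop :=
  ∀ (α : Type) [Fintype α] [DecidableEq α] (F : Sunflower α),
    (F.rainbowCard : ℤ) ≤ ∑ S ∈ (Finset.univ : Finset (Finset α)).filter (fun S => F.lab S = 0), F.cubeSlack Sᶜ

end Sunflower

/-- **`BottomSlackPaysRainbows → PartitionLemmaH`** (this work): by `ZH_eq_six_slack`, ★ is (★_B) plus the nonnegativity of the kernel-spectator
slack `Σ_{lab S = 4} cubeSlack Sᶜ ≥ 0` (`cubeSlack_nonneg`). [this work] -/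
theorem partitionLemmaH_of_bottomSlackPaysRainbows (h : BottomSlackPaysRainbows) : PartitionLemmaH := by
  intro α _ _ F
  have hB := h α F
  have hA : 0 ≤ ∑ S ∈ (Finset.univ : Finset (Finset α)).filter (fun S => F.lab S = 4), F.cubeSlack Sᶜ :=
    Finset.sum_nonneg fun S _ => F.cubeSlack_nonneg Sᶜ
  rw [F.ZH_eq_six_slack]
  linarith

end Summit.CriticalPhenomena.PercolationContinuityZ3.Theorems.SunflowerPartition
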